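import Mathlib
import HarnessLib
import Summits.NavierStokesRegularity.NavierStokesRegularity.Theorems.PoloidalWindowDoorLrcModEntireTwistingTHFlatRidgeCubic
import Summits.NavierStokesRegularity.NavierStokesRegularity.Theorems.PoloidalWindowDoorLrcModEntireTwistingTHFlatTaylor
import Summits.NavierStokesRegularity.NavierStokesRegularity.Theorems.PoloidalWindowDoorLrcModEntireTwistingTHFlatAssembly

/-!
# Item `LrcModEntire` (stmt-NavierStokesRegularity-20428), registry twist_split v8 — THE FLAT LEVER FROM THE BINDER of `stub_T2bFlat` (memo `Cruxes/LrcModEntire/T2B-g15.md` §17c)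
LEAD of item 20428 ns-poloidal-K2-p3 g15 (`--supports stmt-NavierStokesRegularity-20428 --as helper`).  The flat twin of `…TwistingTHRidgeChain.quasiconvexOn_sq_nuZ_of_T2bData` (κ > 0, LEAD g14):
ONE invocation from the clauses of the registered stub `stub_T2bFlat` (class package, global bilinear (TH) `hTH`, Peakless `hpk`, hot-spot normalisation, `hcrit`, «empty planar interior»
`hproper`, the sign `σ` with `σN = |N|`, and the FLAT ridge law «`D²(σv₂(−1,·))(y)[e₀,e₀] + [e₁,e₁] = 0` at every hot point of `P₀`») together with the data of a hot arc in a tube chart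
(as in the κ > 0 chain: `γ, ν`, chart `e`, cold lateral sides at time −1) and UNIFORM QUARTIC DATA along the arc (the forms `Q_s(n,z) = −D⁴(σv₂(−1,·))(γ s)[(nν(s)+ze₂)⁴]/24` uniformly
definite, their minima `m(s) = min_η Q_s(η,1)` attained within `|η| ≤ K`, `|m| ≤ Mb`, a fifth-derivative bound `C₅` of the signed slice and a thin tube `64(C₅/24)r ≤ λ`):
* `quasiconcaveOn_quarticCoeff_of_flatData` — **`m` is quasiconcave on the parameter interval.**  Chain: flat jets at every hot point (`…HotPointPins`/`hcrit`, `…FlatRidgeJet.hessian_eq_zero_of_flatHotPoint`,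
  `…FlatRidgeCubic.cubic_eq_zero_of_flatHotPoint`) ⇒ (F-H′) `…FlatTaylor.quarticRidgeExpansion_of_flatJets` ⇒ `…FlatAssembly.quasiconcaveOn_quarticCoeff_of_peakless` ((Q1)+(LL)+(F-i′)+(F-ii)).
WHAT THIS IS NOT: not a claim about Navier–Stokes regularity and not a proof of `stub_T2bFlat` — the κ-free lever at binder level; the flat cell stays OPEN (bears_on LADDER-NS N0, item 20428 /
crux 19708; OPEN, ⟨27893⟩ OPEN).
-/

noncomputable section

set_option linter.style.longLine false
-- the summit and its single sub-problem share the name (CONVENTIONS §1), as in every Theorems file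
set_option linter.dupNamespace false

namespace Summit.NavierStokesRegularity.NavierStokesRegularity.Theorems.PoloidalWindowDoorLrcModEntireTwistingTHFlatChain

open Set Function Filter Topology Metric
open scoped RealInnerProductSpace InnerProductSpace ContDiff
open Literature.Analysis Literature.Analysis.FluidPDE Literature.Analysis.UnboundedOperators
open Summit.NavierStokesRegularity.NavierStokesRegularity.Theorems
open Summit.NavierStokesRegularity.NavierStokesRegularity.Theorems.LocalSineTubeDoorProfileAlignedWindowRigidityAncient
open Summit.NavierStokesRegularity.NavierStokesRegularity.Theorems.PoloidalWindowDoorLrcModEntireTwistingTHFlatRidgeJet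
open Summit.NavierStokesRegularity.NavierStokesRegularity.Theorems.PoloidalWindowDoorLrcModEntireTwistingTHFlatRidgeCubic
open Summit.NavierStokesRegularity.NavierStokesRegularity.Theorems.PoloidalWindowDoorLrcModEntireTwistingTHFlatTaylor
open Summit.NavierStokesRegularity.NavierStokesRegularity.Theorems.PoloidalWindowDoorLrcModEntireTwistingTHFlatAssembly

variable {C : ℝ} {v : ℝ → EuclideanSpace ℝ (Fin 3) → EuclideanSpace ℝ (Fin 3)}

/-- **THE QUARTIC DEFICIT COEFFICIENT IS QUASICONCAVE ALONG A FLAT HOT ARC — from the binder of `stub_T2bFlat`.**  See the module docstring. -/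
theorem quasiconcaveOn_quarticCoeff_of_flatData (hdec : HasTypeITimeDecay C v) (hcont : ContinuousOn (uncurry v) (Iio (0 : ℝ) ×ˢ univ))
    (hmild : ∀ s t : ℝ, s < t → t < 0 → ∀ x, v t x = heatExtension (v s) (t - s) x - oseenDuhamel 1 s v v t x)
    (hdiv : ∀ t < 0, VectorCalculus.IsDivFree (v t))
    (hTH : ∀ t < 0, ∀ x x' : EuclideanSpace ℝ (Fin 3), x 2 = x' 2 → ∀ b c : Fin 3, b ≠ 2 → c ≠ 2 →
      fderiv ℝ (v t) x (EuclideanSpace.single 2 1) b * fderiv ℝ (v t) x' (EuclideanSpace.single c 1) 2 =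
        fderiv ℝ (v t) x' (EuclideanSpace.single 2 1) c * fderiv ℝ (v t) x (EuclideanSpace.single b 1) 2)
    (hpk : ∀ (s z₀ σ M : ℝ) (K O : Set (EuclideanSpace ℝ (Fin 3))), s < 0 →
      ((σ = 1 ∨ σ = -1) ∧ IsCompact K ∧ K.Nonempty ∧ (∀ y ∈ K, y 2 = z₀ ∧ σ * v s y 2 = M) ∧
        IsOpen O ∧ K ⊆ O ∧ (∀ y ∈ O, y 2 = z₀ → σ * v s y 2 ≤ M) ∧
        (∀ y ∈ O, y 2 = z₀ → σ * v s y 2 = M → y ∈ K)) → False)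
    (hcrit : ∀ y ∈ {y : EuclideanSpace ℝ (Fin 3) | y 2 = 0 ∧ v (-1) y 2 = v (-1) 0 2}, fderiv ℝ (fun x => v (-1) x 2) y = 0)
    (hne : v (-1) 0 2 ≠ 0) (hhot : ∀ t < 0, ∀ x, Real.sqrt (-t) * |v t x 2| ≤ |v (-1) 0 2|)
    (hproper : ∀ y ∈ {y : EuclideanSpace ℝ (Fin 3) | y 2 = 0 ∧ v (-1) y 2 = v (-1) 0 2}, ∀ r : ℝ, 0 < r →
      ∃ y' : EuclideanSpace ℝ (Fin 3), y' 2 = 0 ∧ dist y' y < r ∧ v (-1) y' 2 ≠ v (-1) 0 2)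
    {σ : ℝ} (hσ : σ = 1 ∨ σ = -1) (hσN : σ * v (-1) 0 2 = |v (-1) 0 2|)
    (hflatlaw : ∀ y : EuclideanSpace ℝ (Fin 3), y 2 = 0 → v (-1) y 2 = v (-1) 0 2 →
      fderiv ℝ (fderiv ℝ (fun x => σ * v (-1) x 2)) y (EuclideanSpace.single 0 1) (EuclideanSpace.single 0 1) +
        fderiv ℝ (fderiv ℝ (fun x => σ * v (-1) x 2)) y (EuclideanSpace.single 1 1) (EuclideanSpace.single 1 1) = 0)
    {C₅ : ℝ} (hC₅ : ∀ x, ‖iteratedFDeriv ℝ 5 (fun x => σ * v (-1) x 2) x‖ ≤ C₅)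
    (e : OpenPartialHomeomorph (ℝ × ℝ) (ℝ × ℝ)) {a₁ a₂ r : ℝ} (ha : a₁ ≤ a₂) (hr : 0 < r) (hsrc : Icc a₁ a₂ ×ˢ Icc (-r) r ⊆ e.source)
    {P : ℝ → ℝ × ℝ → EuclideanSpace ℝ (Fin 3)} (hP : ∀ z₀ q, P z₀ q = WithLp.toLp 2 ![q.1, q.2, z₀])
    {γ ν : ℝ → EuclideanSpace ℝ (Fin 3)} (hγν : ∀ s ∈ Icc a₁ a₂, ∀ n z : ℝ, P z (e (s, n)) = γ s + n • ν s + z • EuclideanSpace.single 2 1)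
    (hν : ∀ s ∈ Icc a₁ a₂, ‖ν s‖ ≤ 1) (hγhot : ∀ s ∈ Icc a₁ a₂, γ s 2 = 0 ∧ v (-1) (γ s) 2 = v (-1) 0 2)
    (hlat0 : ∀ a ∈ Icc a₁ a₂, ∀ n : ℝ, (n = r ∨ n = -r) → σ * v (-1) (P 0 (e (a, n))) 2 < σ * v (-1) 0 2)
    {Q : ℝ → ℝ → ℝ → ℝ} (hQ : ∀ s ∈ Icc a₁ a₂, ∀ n z : ℝ,
      Q s n z = -(1 / 24) * iteratedFDeriv ℝ 4 (fun x => σ * v (-1) x 2) (γ s) (fun _ => n • ν s + z • EuclideanSpace.single 2 1))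
    {m η₀ : ℝ → ℝ} {lam K Mb : ℝ} (hlam : 0 < lam) (hK : 0 ≤ K) (hthin : 64 * (C₅ / 24) * r ≤ lam)
    (hdef : ∀ s ∈ Icc a₁ a₂, ∀ n z : ℝ, lam * (n ^ 4 + z ^ 4) ≤ Q s n z)
    (hmin : ∀ s ∈ Icc a₁ a₂, ∀ η : ℝ, m s ≤ Q s η 1) (hη₀ : ∀ s ∈ Icc a₁ a₂, Q s (η₀ s) 1 = m s)
    (hη₀K : ∀ s ∈ Icc a₁ a₂, |η₀ s| ≤ K) (hMb : ∀ s ∈ Icc a₁ a₂, |m s| ≤ Mb) :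
    QuasiconcaveOn ℝ (Icc a₁ a₂) m := by
  have h1 : (-1 : ℝ) < 0 := by norm_num
  -- the signed slice is smooth
  have hslice_an : AnalyticOnNhd ℝ (v (-1)) univ := analyticOnNhd_slice hcont (bdd_of_hasTypeITimeDecay hdec) hmild h1
  have hslice : ContDiff ℝ ∞ (v (-1)) := contDiffOn_univ.1 hslice_an.contDiffOn_of_completeSpace
  set f : EuclideanSpace ℝ (Fin 3) → ℝ := fun x => σ * v (-1) x 2 with hfdef
  have hf : ContDiff ℝ ∞ f := contDiff_const.mul ((EuclideanSpace.proj (𝕜 := ℝ) (2 : Fin 3)).contDiff.comp hslice)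
  have hC0 : 0 ≤ C₅ := (norm_nonneg _).trans (hC₅ 0)
  have he2 : ‖(EuclideanSpace.single 2 (1 : ℝ) : EuclideanSpace ℝ (Fin 3))‖ ≤ 1 := by simp
  -- the expansion at every point of the arc
  have hexp : ∀ s ∈ Icc a₁ a₂, ∀ n z : ℝ, |σ * v (-1) (P z (e (s, n))) 2 - (σ * v (-1) 0 2 - Q s n z)| ≤ C₅ / 24 * (|n| + |z|) ^ 5 := by
    intro s hs n z
    obtain ⟨hy0, hy⟩ := hγhot s hs
    -- flat jets at the hot point `γ s`
    have hg1 : fderiv ℝ f (γ s) = 0 := by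
      have h0 := hcrit (γ s) ⟨hy0, hy⟩
      have hd : DifferentiableAt ℝ (fun x => v (-1) x 2) (γ s) :=
        ((EuclideanSpace.proj (𝕜 := ℝ) (2 : Fin 3)).differentiableAt).comp _ ((hslice.differentiable (by simp)) _)
      rw [hfdef, fderiv_const_mul hd, h0, smul_zero]
    have hg2 : ∀ w, fderiv ℝ (fderiv ℝ f) (γ s) w w = 0 := fun w =>
      hessian_eq_zero_of_flatHotPoint hdec hcont hmild hdiv hTH hne hhot hproper hσN hy0 hy (hflatlaw _ hy0 hy) w w
    have hg3 : ∀ w, fderiv ℝ (fderiv ℝ (fun x => fderiv ℝ f x w)) (γ s) w w = 0 := fun w =>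
      cubic_eq_zero_of_flatHotPoint hdec hcont hmild hdiv hTH hne hhot hproper hσN hy0 hy (hflatlaw _ hy0 hy) w
    have h := quarticRidgeExpansion_of_flatJets hf hC₅ hg1 hg2 hg3 (hν s hs) he2 (Q := Q s) (hQ s hs) n z
    rw [hγν s hs n z]
    have ef : f (γ s) = σ * v (-1) 0 2 := by rw [hfdef]; simp only; rw [hy]
    rw [← ef]
    exact h
  -- the central value of the tube at height 0
  have hmid0 : ∀ a ∈ Icc a₁ a₂, σ * v (-1) (P 0 (e (a, 0))) 2 = σ * v (-1) 0 2 := by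
    intro a ha'
    rw [hγν a ha' 0 0, zero_smul, zero_smul, add_zero, add_zero, (hγhot a ha').2]
  have hhom : ∀ s ∈ Icc a₁ a₂, ∀ η t : ℝ, Q s (η * t) t = t ^ 4 * Q s η 1 := fun s hs η t =>
    quartic_homogeneous f (γ s) (ν s) (EuclideanSpace.single 2 1) (hQ s hs) η t
  exact quasiconcaveOn_quarticCoeff_of_peakless hpk hcont hσ e ha hr hsrc hP hlat0 hmid0 hlam (by positivity) hK hthin hhom hdef hmin hη₀ hη₀K hMb hexp

end Summit.NavierStokesRegularity.NavierStokesRegularity.Theorems.PoloidalWindowDoorLrcModEntireTwistingTHFlatChain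

end
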